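import Summits.KontsevichZagierPeriods.KontsevichZagierPeriods.Theorems.LinRedNormalFormArrangementNormalFormSeparateThreeFatBox
import Summits.KontsevichZagierPeriods.KontsevichZagierPeriods.Theorems.LinRedNormalFormArrangementNormalFormSeparateThreeFatPatch

/-!
# Cancelling a fat letter: divergence (stub `stub_separateThreeZero`, part `FatDiverge`)

(Line `janus-bands`, crux `ArrangementNormalForm`, stub `stub_separateThreeZero` — fibre-free
separation over a bounded rational polytope in `ℝ³`, `JJ 3 0 → closure (GG 2 1 0)`; part
`FatDiverge` of the CANCELLATION lemma `JJ 3 0 ≡ thin JJ 3 0`.)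

**Theorem** (`SepThree.fat_diverge`, registered as `separateThree_fat_diverge`). Let `D ⊆ ℝ³` be
open and convex, `y = λ(x')` a plane (`λ` affine) not meeting `D`, whose graph over a ball
`B(x₁, ρ)` of the base lies in `D̄` (a PATCH, part `FatPatch`), and `g` integrable on `D` with
`|g(z)| ≥ c'/|y − λ(x')|` on `D` near the graph point `z₁` over `x₁` (`c' > 0`). Contradiction.
Proof: for a point `c₀ ∈ D` and the vertical shear chart `Θ` at `x₁` (part `FatBox`), the thin
box `B(0, ρ₂) × (0, ±τ)` is mapped into `D` — `Θ(q)` lies on the open segment from a patch point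
to `c₀` (`Convex.combo_closure_interior_mem_interior`) — and near `z₁`; on it `|g ∘ Θ| ≥ c'/|w|`,
which is not integrable (`SepThree.fat_not_integrableOn_box`), while `g ∘ Θ` is
(`SepThree.fat_shear_transfer`).
-/

noncomputable section

open Set MeasureTheory Filter Topology

namespace Summit.KontsevichZagierPeriods.ArrangementNormalForm.JanusBands

namespace SepThree

/-- **Divergence at a patch**: see the module docstring. -/
theorem fat_diverge {D : Set (Fin (2 + 1) → ℝ)} (hDo : IsOpen D) (hDc : Convex ℝ D)
    {g : (Fin (2 + 1) → ℝ) → ℝ} (hg : IntegrableOn g D) (κ : Fin 2 → ℝ) (cc : ℝ)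
    (x₁ : Fin 2 → ℝ) {ρ : ℝ} (hρ : 0 < ρ)
    (hpatch : ∀ x : Fin 2 → ℝ, dist x x₁ < ρ →
      (Fin.snoc x (κ 0 * x 0 + κ 1 * x 1 + cc) : Fin (2 + 1) → ℝ) ∈ closure D)
    (hℓ : ∀ z ∈ D, z (Fin.last 2) - (κ 0 * z (Fin.castSucc 0) + κ 1 * z (Fin.castSucc 1) + cc) ≠ 0)
    {c' ρ₁ : ℝ} (hc' : 0 < c') (hρ₁ : 0 < ρ₁)
    (hlow : ∀ z ∈ D, dist z (Fin.snoc x₁ (κ 0 * x₁ 0 + κ 1 * x₁ 1 + cc) : Fin (2 + 1) → ℝ) < ρ₁ →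
      c' / |z (Fin.last 2) - (κ 0 * z (Fin.castSucc 0) + κ 1 * z (Fin.castSucc 1) + cc)| ≤ |g z|) :
    False := by
  -- the affine function, the letter, a point of the cell
  set lam : (Fin 2 → ℝ) → ℝ := fun x => κ 0 * x 0 + κ 1 * x 1 + cc with hlam
  set ℓ : (Fin (2 + 1) → ℝ) → ℝ := fun z => z (Fin.last 2) - lam (fun i => z (Fin.castSucc i))
    with hℓdef
  have hℓ' : ∀ z ∈ D, ℓ z ≠ 0 := fun z hz => hℓ z hz
  set z₁ : Fin (2 + 1) → ℝ := Fin.snoc x₁ (lam x₁) with hz₁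
  have hne : D.Nonempty := by
    by_contra h
    rw [Set.not_nonempty_iff_eq_empty] at h
    have := hpatch x₁ (by rw [dist_self]; exact hρ)
    rw [h, closure_empty] at this
    exact this
  obtain ⟨c₀, hc₀⟩ := hne
  set ℓ₀ : ℝ := ℓ c₀ with hℓ₀
  have hℓ₀0 : ℓ₀ ≠ 0 := hℓ' c₀ hc₀
  have hℓ₀a : 0 < |ℓ₀| := abs_pos.2 hℓ₀0
  -- the chart
  set Θ : (Fin 2 → ℝ) × ℝ → (Fin (2 + 1) → ℝ) := fun q => Fin.snoc (x₁ + q.1)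
    (q.2 + (κ 0 * (x₁ 0 + q.1 0) + κ 1 * (x₁ 1 + q.1 1) + cc)) with hΘ
  have hΘy : ∀ q, Θ q (Fin.last 2) = q.2 + lam (x₁ + q.1) := fun q => by
    simp only [hΘ, Fin.snoc_last, hlam, Pi.add_apply]
  have hΘx : ∀ q (i : Fin 2), Θ q (Fin.castSucc i) = x₁ i + q.1 i := fun q i => by
    simp only [hΘ, Fin.snoc_castSucc, Pi.add_apply]
  have hΘℓ : ∀ q, ℓ (Θ q) = q.2 := fun q => by
    simp only [hℓdef, hΘy, hΘx, hlam]
    have e1 : (fun i : Fin 2 => x₁ i + q.1 i) = x₁ + q.1 := rfl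
    simp only [Pi.add_apply]
    ring
  -- the sizes
  set Lκ : ℝ := |κ 0| + |κ 1| + 1 with hLκ
  have hLκ0 : 0 < Lκ := by rw [hLκ]; positivity
  set R₀ : ℝ := dist x₁ (fun i => c₀ (Fin.castSucc i)) with hR₀
  have hR₀0 : 0 ≤ R₀ := dist_nonneg
  set ρ₂ : ℝ := min (ρ / 4) (ρ₁ / (2 * Lκ)) with hρ₂
  have hρ₂0 : 0 < ρ₂ := by rw [hρ₂]; positivity
  have hρ₂a : ρ₂ ≤ ρ / 4 := min_le_left _ _
  have hρ₂b : ρ₂ ≤ ρ₁ / (2 * Lκ) := min_le_right _ _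
  set τ : ℝ := min (min (|ℓ₀| / 2) (ρ * |ℓ₀| / (4 * (R₀ + 1)))) (ρ₁ / 4) with hτ
  have hτ0 : 0 < τ := by rw [hτ]; positivity
  have hτa : τ ≤ |ℓ₀| / 2 := (min_le_left _ _).trans (min_le_left _ _)
  have hτb : τ ≤ ρ * |ℓ₀| / (4 * (R₀ + 1)) := (min_le_left _ _).trans (min_le_right _ _)
  have hτc : τ ≤ ρ₁ / 4 := min_le_right _ _
  -- the key step, for a thin box `B(0, ρ₂) × (a, b)` on the side of `c₀`
  suffices key : ∀ a b : ℝ, a < b → (0 : ℝ) ∈ Set.uIcc a b →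
      (∀ w ∈ Ioo a b, 0 < w / ℓ₀ ∧ |w| < τ) → False by
    rcases lt_or_gt_of_ne hℓ₀0 with hneg | hpos
    · refine key (-τ) 0 (by linarith) (by simp [hτ0.le]) fun w hw => ⟨?_, ?_⟩
      · exact div_pos_of_neg_of_neg hw.2 hneg
      · rw [abs_lt]; exact ⟨hw.1, by linarith [hw.2]⟩
    · refine key 0 τ hτ0 (by simp [hτ0.le]) fun w hw => ⟨div_pos hw.1 hpos, ?_⟩
      rw [abs_lt]; exact ⟨by linarith [hw.1], hw.2⟩
  intro a b hab h0 hI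
  set Box : Set ((Fin 2 → ℝ) × ℝ) := Metric.ball (0 : Fin 2 → ℝ) ρ₂ ×ˢ Ioo a b with hBox
  -- (1) the chart maps the box into the cell, near `z₁`
  have hin : ∀ q ∈ Box, Θ q ∈ D ∧ dist (Θ q) z₁ < ρ₁ := by
    rintro q ⟨hq1, hq2⟩
    rw [Metric.mem_ball, dist_zero_right] at hq1
    obtain ⟨hθ0, hwτ⟩ := hI q.2 hq2
    set θ : ℝ := q.2 / ℓ₀ with hθ
    have hθle : θ ≤ 1 / 2 := by
      have h1 : θ = |q.2| / |ℓ₀| := by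
        rw [hθ, ← abs_div, abs_of_pos hθ0]
      rw [h1, div_le_iff₀ hℓ₀a]; linarith
    have hθ1 : 0 < 1 - θ := by linarith
    -- the patch point below `Θ q`
    set bpt : Fin (2 + 1) → ℝ := (1 - θ)⁻¹ • (Θ q - θ • c₀) with hbpt
    have hcombo : Θ q = (1 - θ) • bpt + θ • c₀ := by
      rw [hbpt, smul_smul, mul_inv_cancel₀ hθ1.ne', one_smul, sub_add_cancel]
    have hbℓ : ℓ bpt = 0 := by
      have e1 : ∀ l, bpt l = (1 - θ)⁻¹ * (Θ q l - θ * c₀ l) := fun l => by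
        simp [hbpt]
      simp only [hℓdef, hlam, e1]
      have e2 : Θ q (Fin.last 2) - θ * c₀ (Fin.last 2) =
          κ 0 * (Θ q (Fin.castSucc 0) - θ * c₀ (Fin.castSucc 0)) +
          κ 1 * (Θ q (Fin.castSucc 1) - θ * c₀ (Fin.castSucc 1)) + (1 - θ) * cc := by
        have h1 := hΘℓ q
        simp only [hℓdef, hlam] at h1
        have h2 : θ * ℓ₀ = q.2 := by rw [hθ, div_mul_cancel₀ _ hℓ₀0]
        simp only [hℓ₀, hℓdef, hlam] at h2
        linarith
      rw [e2]
      field_simp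
      ring
    have hbg := fat_graph_ext κ cc (sub_eq_zero.1 hbℓ)
    have hbdist : dist (fun i : Fin 2 => bpt (Fin.castSucc i)) x₁ < ρ := by
      rw [dist_pi_lt_iff hρ]
      intro i
      have e1 : bpt (Fin.castSucc i) - x₁ i =
          (1 - θ)⁻¹ * (q.1 i + θ * (x₁ i - c₀ (Fin.castSucc i))) := by
        have : bpt (Fin.castSucc i) = (1 - θ)⁻¹ * (Θ q (Fin.castSucc i) - θ * c₀ (Fin.castSucc i)) := by
          simp [hbpt]
        rw [this, hΘx]
        field_simp
        ring
      rw [Real.dist_eq, e1, abs_mul, abs_inv, abs_of_pos hθ1]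
      have hq1i : |q.1 i| < ρ₂ := lt_of_le_of_lt (by
        have := norm_le_pi_norm q.1 i; rwa [Real.norm_eq_abs] at this) hq1
      have hci : |x₁ i - c₀ (Fin.castSucc i)| ≤ R₀ := by
        rw [← Real.dist_eq]; exact dist_le_pi_dist x₁ (fun i => c₀ (Fin.castSucc i)) i
      have hθR : θ * |x₁ i - c₀ (Fin.castSucc i)| ≤ ρ / 4 := by
        have h1 : θ * (R₀ + 1) ≤ ρ / 4 := by
          have h2 : θ = |q.2| / |ℓ₀| := by rw [hθ, ← abs_div, abs_of_pos hθ0]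
          rw [h2, div_mul_eq_mul_div, div_le_iff₀ hℓ₀a]
          have h3 : |q.2| * (R₀ + 1) ≤ τ * (R₀ + 1) := by gcongr
          have h4 : τ * (R₀ + 1) ≤ ρ * |ℓ₀| / 4 := by
            rw [le_div_iff₀ (by positivity)] at hτb
            linarith
          linarith
        calc θ * |x₁ i - c₀ (Fin.castSucc i)| ≤ θ * (R₀ + 1) := by
              exact mul_le_mul_of_nonneg_left (by linarith) hθ0.le
          _ ≤ ρ / 4 := h1
      calc (1 - θ)⁻¹ * |q.1 i + θ * (x₁ i - c₀ (Fin.castSucc i))|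
          ≤ 2 * (|q.1 i| + θ * |x₁ i - c₀ (Fin.castSucc i)|) := by
            have h1 : (1 - θ)⁻¹ ≤ 2 := by
              rw [inv_le_comm₀ hθ1 (by norm_num)]; linarith
            have h2 : |q.1 i + θ * (x₁ i - c₀ (Fin.castSucc i))| ≤
                |q.1 i| + θ * |x₁ i - c₀ (Fin.castSucc i)| := by
              calc _ ≤ |q.1 i| + |θ * (x₁ i - c₀ (Fin.castSucc i))| := abs_add_le _ _
                _ = _ := by rw [abs_mul, abs_of_pos hθ0]
            exact mul_le_mul h1 h2 (abs_nonneg _) (by norm_num)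
        _ < ρ := by linarith
    have hbcl : bpt ∈ closure D := by rw [hbg]; exact hpatch _ hbdist
    have hzD : Θ q ∈ D := by
      have := hDc.combo_closure_interior_mem_interior hbcl (by rwa [hDo.interior_eq]) hθ1.le hθ0
        (by ring)
      rwa [hDo.interior_eq, ← hcombo] at this
    refine ⟨hzD, ?_⟩
    -- distance to `z₁`
    rw [dist_pi_lt_iff hρ₁]
    intro l
    refine Fin.lastCases ?_ (fun i => ?_) l
    · rw [hΘy, hz₁, Fin.snoc_last, Real.dist_eq]
      have e1 : q.2 + lam (x₁ + q.1) - lam x₁ = q.2 + (κ 0 * q.1 0 + κ 1 * q.1 1) := by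
        simp only [hlam, Pi.add_apply]; ring
      rw [e1]
      have hq10 : |q.1 0| < ρ₂ := lt_of_le_of_lt (by
        have := norm_le_pi_norm q.1 0; rwa [Real.norm_eq_abs] at this) hq1
      have hq11 : |q.1 1| < ρ₂ := lt_of_le_of_lt (by
        have := norm_le_pi_norm q.1 1; rwa [Real.norm_eq_abs] at this) hq1
      have hk : |κ 0 * q.1 0 + κ 1 * q.1 1| ≤ Lκ * ρ₂ := by
        calc _ ≤ |κ 0 * q.1 0| + |κ 1 * q.1 1| := abs_add_le _ _
          _ = |κ 0| * |q.1 0| + |κ 1| * |q.1 1| := by rw [abs_mul, abs_mul]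
          _ ≤ |κ 0| * ρ₂ + |κ 1| * ρ₂ := by gcongr
          _ ≤ Lκ * ρ₂ := by rw [hLκ]; nlinarith [abs_nonneg (κ 0), abs_nonneg (κ 1)]
      have hk2 : Lκ * ρ₂ ≤ ρ₁ / 2 := by
        rw [le_div_iff₀ (by positivity)] at hρ₂b; linarith
      calc |q.2 + (κ 0 * q.1 0 + κ 1 * q.1 1)| ≤ |q.2| + |κ 0 * q.1 0 + κ 1 * q.1 1| := abs_add_le _ _
        _ < ρ₁ := by linarith
    · rw [hΘx, hz₁, Fin.snoc_castSucc, Real.dist_eq, add_sub_cancel_left]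
      have hq1i : |q.1 i| < ρ₂ := lt_of_le_of_lt (by
        have := norm_le_pi_norm q.1 i; rwa [Real.norm_eq_abs] at this) hq1
      have hρ₂c : ρ₂ ≤ ρ₁ / 2 := by
        refine hρ₂b.trans ?_
        rw [div_le_div_iff_of_pos_left hρ₁ (by positivity) (by norm_num)]
        have : (1 : ℝ) ≤ Lκ := by
          rw [hLκ]; linarith [abs_nonneg (κ 0), abs_nonneg (κ 1)]
        linarith
      linarith
  -- (2) integrability in the chart and the lower bound
  have hsub : Θ '' Box ⊆ D := by
    rintro _ ⟨q, hq, rfl⟩; exact (hin q hq).1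
  have hI : IntegrableOn (fun q : (Fin 2 → ℝ) × ℝ => g (Θ q)) Box :=
    fat_shear_transfer x₁ κ cc (hg.mono_set hsub)
  have hBoxm : MeasurableSet Box := measurableSet_ball.prod measurableSet_Ioo
  have hI2 : IntegrableOn (fun q : (Fin 2 → ℝ) × ℝ => c' / |q.2|) Box := by
    refine Integrable.mono hI ?_ ?_
    · exact ((measurable_const.div measurable_snd.abs)).aestronglyMeasurable
    · refine (ae_restrict_iff' hBoxm).2 (Eventually.of_forall fun q hq => ?_)
      obtain ⟨hzD, hdist⟩ := hin q hq
      have h1 := hlow (Θ q) hzD hdist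
      have h2 : Θ q (Fin.last 2) - (κ 0 * Θ q (Fin.castSucc 0) + κ 1 * Θ q (Fin.castSucc 1) + cc) =
          q.2 := hΘℓ q
      rw [h2] at h1
      rw [Real.norm_eq_abs, Real.norm_eq_abs, abs_div, abs_abs, abs_of_pos hc']
      exact h1
  have hI3 : IntegrableOn (fun q : (Fin 2 → ℝ) × ℝ => q.2⁻¹) Box := by
    have h1 := hI2.const_mul c'⁻¹
    refine Integrable.mono h1 (measurable_snd.inv).aestronglyMeasurable
      (Eventually.of_forall fun q => ?_)
    have e1 : c'⁻¹ * (c' / |q.2|) = |q.2|⁻¹ := by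
      rw [div_eq_mul_inv, ← mul_assoc, inv_mul_cancel₀ hc'.ne', one_mul]
    rw [Real.norm_eq_abs, Real.norm_eq_abs, e1, abs_inv, abs_inv, abs_abs]
  exact fat_not_integrableOn_box (Metric.measure_ball_pos volume (0 : Fin 2 → ℝ) hρ₂0).ne' hab h0 hI3

end SepThree

open SepThree in
/-- **Divergence at a patch** (registered sub-goal of `stub_separateThreeZero`, part
`FatDiverge`; see `SepThree.fat_diverge`). -/
theorem separateThree_fat_diverge (D : Set (Fin (2 + 1) → ℝ)) (hDo : IsOpen D) (hDc : Convex ℝ D) (g : (Fin (2 + 1) → ℝ) → ℝ) (hg : MeasureTheory.IntegrableOn g D) (κ : Fin 2 → ℝ) (cc : ℝ) (x₁ : Fin 2 → ℝ) (ρ : ℝ) (hρ : 0 < ρ) (hpatch : ∀ x : Fin 2 → ℝ, dist x x₁ < ρ → (Fin.snoc x (κ 0 * x 0 + κ 1 * x 1 + cc) : Fin (2 + 1) → ℝ) ∈ closure D) (hℓ : ∀ z ∈ D, z (Fin.last 2) - (κ 0 * z (Fin.castSucc 0) + κ 1 * z (Fin.castSucc 1) + cc) ≠ 0) (c' ρ₁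 : ℝ) (hc' : 0 < c') (hρ₁ : 0 < ρ₁) (hlow : ∀ z ∈ D, dist z (Fin.snoc x₁ (κ 0 * x₁ 0 + κ 1 * x₁ 1 + cc) : Fin (2 + 1) → ℝ) < ρ₁ → c' / |z (Fin.last 2) - (κ 0 * z (Fin.castSucc 0) + κ 1 * z (Fin.castSucc 1) + cc)| ≤ |g z|) : False :=
  fat_diverge hDo hDc hg κ cc x₁ hρ hpatch hℓ hc' hρ₁ hlow

end Summit.KontsevichZagierPeriods.ArrangementNormalForm.JanusBands
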